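import Summits.MatrixMultiplication.OmegaCensus.STPPKernelListerOrderN53DP15
import Summits.MatrixMultiplication.OmegaCensus.STPPKernelListerKillsZ53

/-!
# ω-census (abelian STPP census): `ℤ₅₃` admits no beating STPP family MODULO the two patterns `{(3,3,3),(3,3,3)}` and `{(2,3,3)³}` (kernel)

HONEST FRAMING (pub-omega census; verbatim): lottery ticket; floor = certified bounds/negative ranges.
Census STRUCTURE (seat pub-omega-stpp-2 gen 30, 2026-08-29), family (b2).  Nothing here is progress on `ω`.  CONDITIONAL THEOREM: the order-53 lister
capstone `KLister.volume_le_of_card_eq_53_of_dead` (dead list `deadN53` = the six tree-law survivors) with four of its six hypotheses discharged by the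
kernel kills of `STPPKernelListerKillsZ53` (`234_235`, `223_332_342` tight tables; `233_233_323`, `233_323_332` slack-1 + Hamidoune–Rødseth).  What remains
are the two patterns the prime-order laws of the tree do not reach: `{(3,3,3),(3,3,3)}` (N18 slack 4 in every reading) and `{(2,3,3),(2,3,3),(2,3,3)}`
(slack 2) — so «ℤ₅₃ NO_BEATING» ⇔ these two explicit patterns are infeasible in `ℤ/53`.
-/

open Finset

namespace Summit.MatrixMultiplication.OmegaCensus.CubeNB

open Literature.Computability.AlgebraicComplexity
open Summit.MatrixMultiplication.OmegaCensus.KLister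

/-- **`ℤ₅₃` admits no beating STPP family PROVIDED `{(3,3,3),(3,3,3)}` and `{(2,3,3),(2,3,3),(2,3,3)}` are not realisable in `ℤ/53`** — for every `m`
and every STPP family `(Aᵢ, Bᵢ, Cᵢ)_{i<m}` of `ℤ/53` (CKSU Def. 5.1), `Σᵢ |Aᵢ||Bᵢ||Cᵢ| ≤ 53`. [cite: CohnKleinbergSzegedyUmans2005, Def. 5.1, Thm. 5.5] -/
theorem volume_le_card_zmod53_of_not_realizable (h333 : ¬ Realizable (ZMod 53) ([(3, 3, 3), (3, 3, 3)] : List Shape))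
    (h233 : ¬ Realizable (ZMod 53) ([(2, 3, 3), (2, 3, 3), (2, 3, 3)] : List Shape))
    {m : ℕ} (A B C : Fin m → Finset (ZMod 53)) (hS : IsSTPP A B C) : ∑ i, #(A i) * #(B i) * #(C i) ≤ 53 := by
  refine volume_le_of_card_eq_53_of_dead (ZMod.card 53) ?_ A B C hS
  intro D hD
  simp only [deadN53, List.mem_cons, List.not_mem_nil, or_false] at hD
  rcases hD with rfl | rfl | rfl | rfl | rfl | rfl
  exacts [notRealizable_Z53_234_235, h333, notRealizable_Z53_223_332_342, h233, notRealizable_Z53_233_233_323,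
    notRealizable_Z53_233_323_332]

end Summit.MatrixMultiplication.OmegaCensus.CubeNB
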